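import Summits.QuantumFields.BalabanUV.Beta.GAN24.AliasFibreBridge
import Summits.QuantumFields.BalabanUV.Beta.GAN24.CapacitanceScalarDictionary

/-!
# `BalabanUV.Beta.GAN24.ArrowAnchorRealWeights` — binder row G-an2-4 / (CONV-C), road P1-fibre, p1 row **P1-L10** `FibreStrip` ((I3′)), leaf-16's cut (M4)
# `L10-CUT-M4.md` row **F5 `ArrowAnchorReal`** (OUTER ANCHOR), PREP PART (ii′): MODULI OF THE ARROW BORDER WEIGHTS AT A REAL MOMENTUM

NOT IN PRINT; OUR PROOF ATTEMPT.  HONEST FRAMING (cell contract, verbatim): «discharging `BetaPertH` makes Bałaban's UV stability UNCONDITIONAL — a real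
constructive-QFT result; it is NOT the continuum limit and NOT the Clay problem.»  HONEST DEPENDENCY (verbatim): «continuum YM on T⁴ ⇐ BetaPertH ∧ nine spine
estimates (0/9 proved); BetaPertH ⇐ (D1) ∧ (D4) ∧ CAP+tail; G-an2-4 gates asym, D1 and NE2/3/4.»  [folklore] dictionary over leaf-06's `FibreArrow`/`AliasFibreBridge`
(the arrow weights `chiHat`, `sflat`, `boxS`, `boxSs` of F1a `ArrowOperator.aliasArrow`), T00 `AliasObjects` and leaf-12's `CapacitanceScalarDictionary` — every input BY
NAME; no cited fact, no wall binder, no `def`, no `def … : Prop`.  NOT summit progress: nothing of (CONV-C)'s K-slot `GAN24.CombesThomas.ConvCK 3 Lc` is discharged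
here; 0 wall binders; NOT `BetaPertH`, NOT continuum, NOT Clay.

## What is proved (every `D`, `N ≥ 1`, every real `q`, every alias `m : (ℤ/N)^D`, every `κ`; `p = ofRealVec q`)
The SQUARED MODULI of the four raw border weights of `aliasArrow N p` (`wE = χ̂·s♭`, `wG = χ̂`, `wM = S`, `wQ = S·s_κ`) in leaf-12's REAL currency
(`blockWt N q m = |S(m)|²/N^D`, `gNormSq N (kfine N q m κ) = |s_κ(m)|²`):
* `norm_sq_boxS : ‖boxS p m‖² = blockWt N q m · N^D`, `norm_sq_chiHat : ‖chiHat p m‖² = blockWt N q m / N^D`,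
  `norm_sq_sflat : ‖sflat p m κ‖² = gNormSq N (kfine N q m κ)`, `norm_sq_boxSs : ‖boxSs p m κ‖² = blockWt N q m · N^D · gNormSq N (kfine N q m κ)`,
  `norm_sq_chiHat_mul_sflat : ‖chiHat p m · sflat p m κ‖² = blockWt N q m · gNormSq N (kfine N q m κ) / N^D`;
* `norm_lapSym_kFine : ‖lapSym (kFine p m)‖ = lapR (kfine N q m)` (so F1c's outer radii are `radO N q m = N·√‖L_m‖`);
* the SCALED forms with arbitrary real scale factors `a, b`: `‖↑a · w · ↑b‖² = a²·‖w‖²·b²` packaged for each weight (`norm_sq_scaled`).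
Consumer: F5 proper — with F1c's outer scalings these squared moduli ARE the summands of `ArrowAnchorRealBorders` (p202971), whose four alias sums are O(1).
Unit `b2b-balaban-gan24-formalise-leaf-12` (G-an2-4 formalisation swarm, leaf prover 12, gen 7), 2026-08-20.  Value = kernel bookkeeping toward (I3′), NOT summit
progress.
-/

noncomputable section

open Complex Finset
open scoped BigOperators Real ComplexConjugate

namespace Summit.QuantumFields.BalabanUV.Beta.GAN24.ArrowAnchorRealWeights

open Literature.MathematicalPhysics.QuantumFieldTheory.Balaban1983to89.B4Strip (ofRealVec)
open Literature.Probability.LatticeModels (TorusSite)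
open FibreSymbols (lapSym)
open FibreDFT (kFine)
open FibreArrow (chiHat sflat boxS boxSs)
open AliasObjects (sAl SAl sbAl SbAl chiAl conj_ofRealVec sbAl_eq_conj SbAl_eq_conj)
open AliasFibreBridge (sflat_eq_sbAl boxS_eq_SAl chiHat_eq_chiAl boxSs_eq_SAl_mul_sAl)
open AliasWeights (kfine)
open AliasWeightsSum (lapR)
open CapacitanceScalarBounds (gNormSq blockWt blockWt_nonneg)
open CapacitanceScalarDictionary (norm_sq_sAl normSq_SAl LAl_ofRealVec)

variable {D : ℕ} {N : ℕ} [NeZero N]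

/-! ## §1 The raw weights at a real momentum -/

/-- [folklore] `‖S(m)‖² = Π_i gNormSq N k_{m,i}` at real momentum. -/
theorem norm_sq_SAl (q : Fin D → ℝ) (m : TorusSite D N) : ‖SAl N (ofRealVec q) m‖ ^ 2 = ∏ i, gNormSq N (kfine N q m i) := by
  rw [← Complex.normSq_eq_norm_sq, normSq_SAl]

omit [NeZero N] in
/-- [folklore] `Π_i gNormSq N k_{m,i} = blockWt · N^D` (`N ≥ 1`). -/
theorem prod_gNormSq_eq (hN : 1 ≤ N) (q : Fin D → ℝ) (m : TorusSite D N) :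
    ∏ i, gNormSq N (kfine N q m i) = blockWt N q m * (N : ℝ) ^ D := by
  have hN0 : (0 : ℝ) < N := by exact_mod_cast hN
  unfold blockWt
  rw [div_mul_cancel₀ _ (pow_ne_zero _ hN0.ne')]

/-- [folklore] **`‖boxS p m‖² = blockWt · N^D`** (`wM = S(m)`). -/
theorem norm_sq_boxS (hN : 1 ≤ N) (q : Fin D → ℝ) (m : TorusSite D N) :
    ‖boxS (ofRealVec q) m‖ ^ 2 = blockWt N q m * (N : ℝ) ^ D := by
  rw [boxS_eq_SAl, norm_sq_SAl, prod_gNormSq_eq hN]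

/-- [folklore] `‖S♭(m)‖ = ‖S(m)‖` at real momentum. -/
theorem norm_SbAl (q : Fin D → ℝ) (m : TorusSite D N) : ‖SbAl N (ofRealVec q) m‖ = ‖SAl N (ofRealVec q) m‖ := by
  rw [SbAl_eq_conj (conj_ofRealVec q), Complex.norm_conj]

/-- [folklore] **`‖chiHat p m‖² = blockWt / N^D`** (`wG = χ̂(m) = S♭(m)/N^D`). -/
theorem norm_sq_chiHat (hN : 1 ≤ N) (q : Fin D → ℝ) (m : TorusSite D N) :
    ‖chiHat (ofRealVec q) m‖ ^ 2 = blockWt N q m / (N : ℝ) ^ D := by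
  have hN0 : (0 : ℝ) < N := by exact_mod_cast hN
  have hND : (0 : ℝ) < (N : ℝ) ^ D := by positivity
  rw [chiHat_eq_chiAl]
  unfold chiAl
  rw [norm_div, norm_SbAl, div_pow, norm_sq_SAl, prod_gNormSq_eq hN, norm_pow, Complex.norm_natCast]
  field_simp

/-- [folklore] **`‖sflat p m κ‖² = gNormSq N k_{m,κ}`** (`s♭_κ(m) = conj s_κ(m)` at real momentum). -/
theorem norm_sq_sflat (q : Fin D → ℝ) (m : TorusSite D N) (κ : Fin D) :
    ‖sflat (ofRealVec q) m κ‖ ^ 2 = gNormSq N (kfine N q m κ) := by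
  rw [sflat_eq_sbAl, sbAl_eq_conj (conj_ofRealVec q), Complex.norm_conj, norm_sq_sAl]

/-- [folklore] **`‖boxSs p m κ‖² = blockWt · N^D · gNormSq_κ`** (`wQ = S(m)·s_κ(m)`). -/
theorem norm_sq_boxSs (hN : 1 ≤ N) (q : Fin D → ℝ) (m : TorusSite D N) (κ : Fin D) :
    ‖boxSs (ofRealVec q) m κ‖ ^ 2 = blockWt N q m * (N : ℝ) ^ D * gNormSq N (kfine N q m κ) := by
  rw [boxSs_eq_SAl_mul_sAl, norm_mul, mul_pow, norm_sq_SAl, prod_gNormSq_eq hN, norm_sq_sAl]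

/-- [folklore] **`‖chiHat p m · sflat p m κ‖² = blockWt · gNormSq_κ / N^D`** (`wE = χ̂·s♭`). -/
theorem norm_sq_chiHat_mul_sflat (hN : 1 ≤ N) (q : Fin D → ℝ) (m : TorusSite D N) (κ : Fin D) :
    ‖chiHat (ofRealVec q) m * sflat (ofRealVec q) m κ‖ ^ 2 = blockWt N q m * gNormSq N (kfine N q m κ) / (N : ℝ) ^ D := by
  rw [norm_mul, mul_pow, norm_sq_chiHat hN, norm_sq_sflat]
  ring

/-- [folklore] **The Laplacian symbol of an alias at real momentum is `lapR`**: `‖lapSym (kFine p m)‖ = lapR (kfine N q m)` (and it IS the real number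
`lapR`, by leaf-12's `LAl_ofRealVec`). -/
theorem norm_lapSym_kFine (q : Fin D → ℝ) (m : TorusSite D N) : ‖lapSym (kFine (ofRealVec q) m)‖ = lapR (kfine N q m) := by
  have h : lapSym (kFine (ofRealVec q) m) = ((lapR (kfine N q m) : ℝ) : ℂ) := LAl_ofRealVec q m
  rw [h, Complex.norm_real, Real.norm_of_nonneg (AliasWeightsSum.lapR_nonneg _)]

/-- [folklore] `lapSym (kFine p m) = ↑(lapR (kfine N q m))` (re-export of leaf-12's `LAl_ofRealVec` in F1a's `kFine` spelling). -/
theorem lapSym_kFine_ofRealVec (q : Fin D → ℝ) (m : TorusSite D N) : lapSym (kFine (ofRealVec q) m) = ((lapR (kfine N q m) : ℝ) : ℂ) :=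
  LAl_ofRealVec q m

/-! ## §2 Scaled weights: real scale factors pass through the modulus -/

/-- [folklore] `‖↑a · w · ↑b‖² = a² · ‖w‖² · b²` for real `a, b`. -/
theorem norm_sq_scaled (a b : ℝ) (w : ℂ) : ‖(a : ℂ) * w * (b : ℂ)‖ ^ 2 = a ^ 2 * ‖w‖ ^ 2 * b ^ 2 := by
  rw [norm_mul, norm_mul, Complex.norm_real, Complex.norm_real, mul_pow, mul_pow, Real.norm_eq_abs, Real.norm_eq_abs, sq_abs, sq_abs]

/-- [folklore] `‖↑a · w‖² = a² · ‖w‖²` for real `a`. -/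
theorem norm_sq_scaled_left (a : ℝ) (w : ℂ) : ‖(a : ℂ) * w‖ ^ 2 = a ^ 2 * ‖w‖ ^ 2 := by
  rw [norm_mul, Complex.norm_real, mul_pow, Real.norm_eq_abs, sq_abs]

/-- [folklore] SCALED `wE`: `‖↑a·(χ̂·s♭_κ)·↑b‖² = a²·b²·blockWt·gNormSq_κ/N^D` (F1c: `a = N²/r_m²`, `b = r₀²/N³` ⇒ the `ArrowAnchorRealBorders.sum_wE_sq_le` summand). -/
theorem norm_sq_scaled_wE (hN : 1 ≤ N) (q : Fin D → ℝ) (m : TorusSite D N) (κ : Fin D) (a b : ℝ) :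
    ‖(a : ℂ) * (chiHat (ofRealVec q) m * sflat (ofRealVec q) m κ) * (b : ℂ)‖ ^ 2
      = a ^ 2 * b ^ 2 * (blockWt N q m * gNormSq N (kfine N q m κ) / (N : ℝ) ^ D) := by
  rw [norm_sq_scaled, norm_sq_chiHat_mul_sflat hN]; ring

/-- [folklore] SCALED `wG`: `‖↑a·χ̂·↑b‖² = a²·b²·blockWt/N^D` (F1c: `a = N³/r_m³`, `b = r₀³/N³`). -/
theorem norm_sq_scaled_wG (hN : 1 ≤ N) (q : Fin D → ℝ) (m : TorusSite D N) (a b : ℝ) :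
    ‖(a : ℂ) * chiHat (ofRealVec q) m * (b : ℂ)‖ ^ 2 = a ^ 2 * b ^ 2 * (blockWt N q m / (N : ℝ) ^ D) := by
  rw [norm_sq_scaled, norm_sq_chiHat hN]; ring

/-- [folklore] SCALED `wM`: `‖↑a·S·↑b‖² = a²·b²·blockWt·N^D` (F1c: `a = r₀/N^{D+1}`, `b = N/r_m`). -/
theorem norm_sq_scaled_wM (hN : 1 ≤ N) (q : Fin D → ℝ) (m : TorusSite D N) (a b : ℝ) :
    ‖(a : ℂ) * boxS (ofRealVec q) m * (b : ℂ)‖ ^ 2 = a ^ 2 * b ^ 2 * (blockWt N q m * (N : ℝ) ^ D) := by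
  rw [norm_sq_scaled, norm_sq_boxS hN]; ring

/-- [folklore] SCALED `wQ`: `‖↑a·(S·s_κ)‖² = a²·blockWt·N^D·gNormSq_κ` (F1c: `a = N^{−(D+1)}`, column scale `1`). -/
theorem norm_sq_scaled_wQ (hN : 1 ≤ N) (q : Fin D → ℝ) (m : TorusSite D N) (κ : Fin D) (a : ℝ) :
    ‖(a : ℂ) * boxSs (ofRealVec q) m κ‖ ^ 2 = a ^ 2 * (blockWt N q m * (N : ℝ) ^ D * gNormSq N (kfine N q m κ)) := by
  rw [norm_sq_scaled_left, norm_sq_boxSs hN]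

/-! ## §3 The outer scalings evaluated (F1c's numbers): the squared moduli ARE the `ArrowAnchorRealBorders` summands -/

omit [NeZero N] in
/-- [folklore] OUTER-SCALED `wE` with `a = N²/r_m²`, `b = r₀²/N³` where `r_m² = N²L_m > 0`, `r₀² = N²L₀`:
`a²b²·blockWt·gNormSq_κ/N^D = blockWt·gNormSq_κ·(N²L₀)²/(N^{D+2}(N²L_m)²)`. -/
theorem outer_wE_summand (hN : 1 ≤ N) (q : Fin D → ℝ) (m : TorusSite D N) (κ : Fin D) {Rm R0 : ℝ} (hRm : 0 < Rm) :
    ((N : ℝ) ^ 2 / Rm) ^ 2 * (R0 / (N : ℝ) ^ 3) ^ 2 * (blockWt N q m * gNormSq N (kfine N q m κ) / (N : ℝ) ^ D)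
      = blockWt N q m * gNormSq N (kfine N q m κ) * R0 ^ 2 / ((N : ℝ) ^ (D + 2) * Rm ^ 2) := by
  have hN0 : (0 : ℝ) < N := by exact_mod_cast hN
  rw [pow_add]; field_simp

omit [NeZero N] in
/-- [folklore] OUTER-SCALED `wG` with `a = (N²/r_m²)^{3/2}`-type factor written through squares: `(N³)²/(Rm)³ · (R0³)/(N³)² · blockWt/N^D = (blockWt/N^D)·R0³/Rm³`
(the squared scale factors are `N⁶/r_m⁶ = N⁶/Rm³` and `r₀⁶/N⁶ = R0³/N⁶`). -/
theorem outer_wG_summand (hN : 1 ≤ N) (q : Fin D → ℝ) (m : TorusSite D N) {Rm R0 : ℝ} (hRm : 0 < Rm) :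
    ((N : ℝ) ^ 6 / Rm ^ 3) * (R0 ^ 3 / (N : ℝ) ^ 6) * (blockWt N q m / (N : ℝ) ^ D)
      = blockWt N q m / (N : ℝ) ^ D * (R0 ^ 3 / Rm ^ 3) := by
  have hN0 : (0 : ℝ) < N := by exact_mod_cast hN
  field_simp

omit [NeZero N] in
/-- [folklore] OUTER-SCALED `wM` with squared factors `r₀²/N^{2(D+1)} = R0/N^{2D+2}` and `N²/r_m² = N²/Rm`:
`(R0/N^{2D+2})·(N²/Rm)·blockWt·N^D = (blockWt/N^D)·R0/Rm`. -/
theorem outer_wM_summand (hN : 1 ≤ N) (q : Fin D → ℝ) (m : TorusSite D N) {Rm R0 : ℝ} (hRm : 0 < Rm) :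
    (R0 / (N : ℝ) ^ (2 * D + 2)) * ((N : ℝ) ^ 2 / Rm) * (blockWt N q m * (N : ℝ) ^ D)
      = blockWt N q m / (N : ℝ) ^ D * (R0 / Rm) := by
  have hN0 : (0 : ℝ) < N := by exact_mod_cast hN
  have e : (N : ℝ) ^ (2 * D + 2) = (N : ℝ) ^ D * (N : ℝ) ^ D * (N : ℝ) ^ 2 := by rw [← pow_add, ← pow_add]; ring_nf
  rw [e]; field_simp

omit [NeZero N] in
/-- [folklore] OUTER-SCALED `wQ` with squared factor `N^{−2(D+1)}`: `N^{−(2D+2)}·blockWt·N^D·gNormSq_κ = blockWt·gNormSq_κ/N^{D+2}`. -/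
theorem outer_wQ_summand (hN : 1 ≤ N) (q : Fin D → ℝ) (m : TorusSite D N) (κ : Fin D) :
    (((N : ℝ) ^ (D + 1))⁻¹) ^ 2 * (blockWt N q m * (N : ℝ) ^ D * gNormSq N (kfine N q m κ))
      = blockWt N q m * gNormSq N (kfine N q m κ) / (N : ℝ) ^ (D + 2) := by
  have hN0 : (0 : ℝ) < N := by exact_mod_cast hN
  have e : ((N : ℝ) ^ (D + 1)) ^ 2 = (N : ℝ) ^ D * (N : ℝ) ^ (D + 2) := by rw [← pow_mul, ← pow_add]; ring_nf
  rw [inv_pow, e]; field_simp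

end Summit.QuantumFields.BalabanUV.Beta.GAN24.ArrowAnchorRealWeights

end
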